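import Mathlib.Algebra.QuadraticDiscriminant
import Mathlib.MeasureTheory.Group.Integral
import Mathlib.MeasureTheory.Function.LocallyIntegrable
import Literature.NumberTheory.LFunctions.WeilGroundEnergyParitySplit
import Literature.NumberTheory.LFunctions.WeilMellinBounds
import Literature.NumberTheory.LFunctions.ZetaZeros
import HarnessLib

/-!
# Crux `OffLineParityDetection`, line `registered`: stub EVEN-CS (the Cauchy–Schwarz threshold)

Route `WeilParity`, crux
`Summit.RiemannHypothesis.RiemannHypothesis.Theses.WeilParity.OffLineParityDetection`
(item stmt-RiemannHypothesis-15431), line `registered`.  This file proves the registered stub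
`stub_evenOffLineCauchySchwarz` BY NAME, with the registered signature: for a REAL, EVEN,
`L²`-normalised Weil test `e` supported in `[-a, a]` and the finite set `S` of off-line zeros,
`-Σ_{ρ ∈ S} m(ρ) ∫_{-a}^{a} sinh²((Re ρ - 1/2) t) sin²((Im ρ) t) dt ≤ Σ_{ρ ∈ S} m(ρ) Re ê(ρ)²`.

## Proof

Termwise in `ρ`: the weights `m(ρ) = riemannZetaZeroOrder ρ` are `≥ 0` because `Re ρ < 1` forces
`ρ ≠ 1` (`riemannZetaZeroOrder_nonneg`).  Fix `ρ`, put `η = Re ρ - 1/2`, `γ = Im ρ`, `w = ê(ρ)`.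
* `Re w² = (Re w)² - (Im w)² ≥ -(Im w)²`.
* `Im w = ∫ Im (e(t) e^{(ρ - 1/2) t}) dt = ∫ e(t) e^{ηt} sin(γt) dt` (`e` real, `integral_im`), and
  since `e` is even the odd part `∫ e(t) cosh(ηt) sin(γt) dt` vanishes (`t ↦ -t`,
  `integral_neg_eq_self`), leaving `Im w = ∫ e(t) sinh(ηt) sin(γt) dt`, an integral over `[-a, a]`
  because `e` vanishes off its support.
* Cauchy–Schwarz on `[-a, a]` (discriminant of the non-negative quadratic `λ ↦ ∫ (λ u - k)²`,
  `discrim_le_zero`): `(Im w)² ≤ (∫_{-a}^{a} e²) · ∫_{-a}^{a} sinh²(ηt) sin²(γt) dt`, and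
  `∫_{-a}^{a} e² = ∫ |e|² = 1`.
-/

-- the problem directory `RiemannHypothesis/RiemannHypothesis` fixes the namespace (gate convention)
set_option linter.dupNamespace false

noncomputable section

open MeasureTheory Set
open scoped ComplexConjugate

namespace Summit.RiemannHypothesis.RiemannHypothesis.Theorems.WeilParityOffLineParityDetection

open Literature.NumberTheory.LFunctions

/-! ## Cauchy–Schwarz, squared form -/

/-- **Cauchy–Schwarz, squared form**, for real functions against an arbitrary measure:
`(∫ u k)² ≤ (∫ u²) (∫ k²)` whenever `u²`, `k²` and `u k` are integrable (the discriminant of the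
non-negative quadratic `λ ↦ ∫ (λ u - k)²` is `≤ 0`). [folklore] -/
theorem sq_integral_mul_le {α : Type*} [MeasurableSpace α] {μ : Measure α} {u k : α → ℝ}
    (hu : Integrable (fun x ↦ u x ^ 2) μ) (hk : Integrable (fun x ↦ k x ^ 2) μ)
    (huk : Integrable (fun x ↦ u x * k x) μ) :
    (∫ x, u x * k x ∂μ) ^ 2 ≤ (∫ x, u x ^ 2 ∂μ) * ∫ x, k x ^ 2 ∂μ := by
  have hq : ∀ l : ℝ, 0 ≤ (∫ x, u x ^ 2 ∂μ) * (l * l) + (-2 * ∫ x, u x * k x ∂μ) * l +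
      ∫ x, k x ^ 2 ∂μ := by
    intro l
    have h0 : 0 ≤ ∫ x, (l * u x - k x) ^ 2 ∂μ := integral_nonneg fun x ↦ sq_nonneg _
    have hexp : ∫ x, (l * u x - k x) ^ 2 ∂μ =
        (∫ x, u x ^ 2 ∂μ) * (l * l) + (-2 * ∫ x, u x * k x ∂μ) * l + ∫ x, k x ^ 2 ∂μ := by
      have e1 : (fun x ↦ (l * u x - k x) ^ 2) =
          fun x ↦ l * l * u x ^ 2 + -2 * l * (u x * k x) + k x ^ 2 := by
        funext x; ring
      have hi : Integrable (fun x ↦ l * l * u x ^ 2 + -2 * l * (u x * k x)) μ :=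
        (hu.const_mul _).add (huk.const_mul _)
      rw [e1, integral_add hi hk, integral_add (hu.const_mul _) (huk.const_mul _),
        integral_const_mul, integral_const_mul]
      ring
    rw [← hexp]
    exact h0
  have hd := discrim_le_zero hq
  rw [discrim] at hd
  nlinarith [hd]

/-! ## Parity bookkeeping for real even weights -/

/-- For an even real `u`: `∫ u(t) cosh(ηt) sin(γt) dt = 0` (the integrand is odd and Lebesgue
measure is invariant under `t ↦ -t`; no integrability is needed). [folklore] -/
theorem integral_even_mul_cosh_mul_sin {u : ℝ → ℝ} (hu : ∀ t, u (-t) = u t) (η γ : ℝ) :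
    ∫ t : ℝ, u t * (Real.cosh (η * t) * Real.sin (γ * t)) = 0 := by
  have h1 : ∫ t : ℝ, u (-t) * (Real.cosh (η * -t) * Real.sin (γ * -t)) =
      ∫ t : ℝ, u t * (Real.cosh (η * t) * Real.sin (γ * t)) :=
    integral_neg_eq_self (fun t : ℝ ↦ u t * (Real.cosh (η * t) * Real.sin (γ * t))) volume
  have h2 : ∀ t : ℝ, u (-t) * (Real.cosh (η * -t) * Real.sin (γ * -t)) =
      -(u t * (Real.cosh (η * t) * Real.sin (γ * t))) := by
    intro t
    rw [hu t, mul_neg, mul_neg, Real.cosh_neg, Real.sin_neg]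
    ring
  simp_rw [h2, integral_neg] at h1
  linarith

/-- For an even, continuous, compactly supported real `u`:
`∫ u(t) e^{ηt} sin(γt) dt = ∫ u(t) sinh(ηt) sin(γt) dt` (`e^{ηt} = cosh(ηt) + sinh(ηt)` and the
`cosh` part drops out by `integral_even_mul_cosh_mul_sin`). [folklore] -/
theorem integral_even_mul_exp_mul_sin {u : ℝ → ℝ} (hc : Continuous u) (hs : HasCompactSupport u)
    (hu : ∀ t, u (-t) = u t) (η γ : ℝ) :
    ∫ t : ℝ, u t * (Real.exp (η * t) * Real.sin (γ * t)) =
      ∫ t : ℝ, u t * (Real.sinh (η * t) * Real.sin (γ * t)) := by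
  have hint1 : Integrable fun t : ℝ ↦ u t * (Real.cosh (η * t) * Real.sin (γ * t)) :=
    (hc.mul (by fun_prop)).integrable_of_hasCompactSupport hs.mul_right
  have hint2 : Integrable fun t : ℝ ↦ u t * (Real.sinh (η * t) * Real.sin (γ * t)) :=
    (hc.mul (by fun_prop)).integrable_of_hasCompactSupport hs.mul_right
  have hsplit : ∀ t : ℝ, u t * (Real.exp (η * t) * Real.sin (γ * t)) =
      u t * (Real.cosh (η * t) * Real.sin (γ * t)) +
        u t * (Real.sinh (η * t) * Real.sin (γ * t)) := by
    intro t
    rw [← Real.cosh_add_sinh]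
    ring
  simp_rw [hsplit]
  rw [integral_add hint1 hint2, integral_even_mul_cosh_mul_sin hu, zero_add]

/-! ## The imaginary part of the Weil transform of a real even test -/

/-- For a REAL test `e` and `ρ = 1/2 + η + iγ`: `Im ê(ρ) = ∫ Re e(t) · e^{ηt} sin(γt) dt`
(`integral_im`, `Im (x e^{z}) = x e^{Re z} sin (Im z)` for real `x`). [folklore] -/
theorem im_weilMellin_of_real {e : ℝ → ℂ} (he : IsWeilTest e) (hreal : ∀ t, (e t).im = 0)
    (ρ : ℂ) :
    (weilMellin e ρ).im =
      ∫ t : ℝ, (e t).re * (Real.exp ((ρ.re - 1 / 2) * t) * Real.sin (ρ.im * t)) := by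
  have hint := integrable_weilIntegrand he.1.continuous he.2 ρ
  have h1 : (weilMellin e ρ).im = ∫ t : ℝ, (e t * Complex.exp ((ρ - 1 / 2) * t)).im := by
    rw [weilMellin, ← RCLike.im_to_complex, ← integral_im hint]
    rfl
  rw [h1]
  congr 1 with t
  have hre : ((ρ - 1 / 2) * (t : ℂ)).re = (ρ.re - 1 / 2) * t := by
    simp [Complex.mul_re]
  have him : ((ρ - 1 / 2) * (t : ℂ)).im = ρ.im * t := by
    simp [Complex.mul_im]
  rw [Complex.mul_im, hreal t, zero_mul, add_zero, Complex.exp_im, hre, him]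

/-- For a REAL EVEN test `e` supported in `[-a, a]` and `ρ = 1/2 + η + iγ`:
`Im ê(ρ) = ∫_{-a}^{a} Re e(t) · sinh(ηt) sin(γt) dt`. [folklore] -/
theorem im_weilMellin_of_real_even {a : ℝ} {e : ℝ → ℂ} (he : IsWeilTest e)
    (hsupp : tsupport e ⊆ Icc (-a) a) (heven : ∀ t, e (-t) = e t) (hreal : ∀ t, (e t).im = 0)
    (ρ : ℂ) :
    (weilMellin e ρ).im = ∫ t in Icc (-a) a,
      (e t).re * (Real.sinh ((ρ.re - 1 / 2) * t) * Real.sin (ρ.im * t)) := by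
  have hu_cont : Continuous fun t ↦ (e t).re := Complex.continuous_re.comp he.1.continuous
  have hu_supp : HasCompactSupport fun t ↦ (e t).re :=
    he.2.comp_left (g := Complex.re) Complex.zero_re
  have hu_even : ∀ t, (e (-t)).re = (e t).re := fun t ↦ by rw [heven t]
  rw [im_weilMellin_of_real he hreal ρ,
    integral_even_mul_exp_mul_sin (u := fun t ↦ (e t).re) hu_cont hu_supp hu_even]
  symm
  refine setIntegral_eq_integral_of_forall_compl_eq_zero fun t ht ↦ ?_
  have h0 : e t = 0 := image_eq_zero_of_notMem_tsupport fun h ↦ ht (hsupp h)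
  simp [h0]

/-! ## The termwise bound and the registered stub -/

/-- **The Cauchy–Schwarz threshold, one zero at a time.**  For a REAL EVEN `L²`-normalised Weil test
`e` supported in `[-a, a]` and every `ρ`:
`-∫_{-a}^{a} sinh²((Re ρ - 1/2) t) sin²((Im ρ) t) dt ≤ Re ê(ρ)²`, because
`Re ê(ρ)² ≥ -(Im ê(ρ))²`, `Im ê(ρ) = ∫_{-a}^{a} Re e · sinh sin` (`im_weilMellin_of_real_even`) and
`(∫_{-a}^{a} Re e · sinh sin)² ≤ (∫_{-a}^{a} (Re e)²) (∫_{-a}^{a} sinh² sin²)` with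
`∫_{-a}^{a} (Re e)² = ∫ |e|² = 1`. [folklore] -/
theorem neg_integral_sinh_sq_mul_sin_sq_le {a : ℝ} {e : ℝ → ℂ} (he : IsWeilTest e)
    (hsupp : tsupport e ⊆ Icc (-a) a) (heven : ∀ t, e (-t) = e t) (hreal : ∀ t, (e t).im = 0)
    (hnorm : ∫ t, ‖e t‖ ^ 2 = (1 : ℝ)) (ρ : ℂ) :
    -(∫ t in Icc (-a) a, Real.sinh ((ρ.re - 1 / 2) * t) ^ 2 * Real.sin (ρ.im * t) ^ 2) ≤
      ((weilMellin e ρ) ^ 2).re := by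
  have hu_cont : Continuous fun t ↦ (e t).re := Complex.continuous_re.comp he.1.continuous
  have hk_cont : Continuous fun t : ℝ ↦ Real.sinh ((ρ.re - 1 / 2) * t) * Real.sin (ρ.im * t) := by
    fun_prop
  -- Cauchy–Schwarz on `[-a, a]`
  have hCS := sq_integral_mul_le (μ := volume.restrict (Icc (-a) a))
    ((hu_cont.pow 2).integrableOn_Icc (a := -a) (b := a))
    ((hk_cont.pow 2).integrableOn_Icc (a := -a) (b := a))
    ((hu_cont.mul hk_cont).integrableOn_Icc (a := -a) (b := a))
  -- `∫_{-a}^{a} (Re e)² = ∫ |e|² = 1`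
  have hA : ∫ t in Icc (-a) a, (fun t ↦ (e t).re) t ^ 2 = 1 := by
    have h1 : (fun t ↦ (fun t ↦ (e t).re) t ^ 2) = fun t ↦ ‖e t‖ ^ 2 := by
      funext t
      rw [Complex.sq_norm, Complex.normSq_apply, hreal t]
      ring
    rw [h1, setIntegral_eq_integral_of_forall_compl_eq_zero, hnorm]
    intro t ht
    have h0 : e t = 0 := image_eq_zero_of_notMem_tsupport fun h ↦ ht (hsupp h)
    simp [h0]
  have hB : ∫ t in Icc (-a) a, Real.sinh ((ρ.re - 1 / 2) * t) ^ 2 * Real.sin (ρ.im * t) ^ 2 =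
      ∫ t in Icc (-a) a,
        (fun t : ℝ ↦ Real.sinh ((ρ.re - 1 / 2) * t) * Real.sin (ρ.im * t)) t ^ 2 := by
    congr 1 with t
    ring
  have hre : ((weilMellin e ρ) ^ 2).re = (weilMellin e ρ).re ^ 2 - (weilMellin e ρ).im ^ 2 := by
    rw [sq, Complex.mul_re]
    ring
  rw [hA, one_mul] at hCS
  rw [hB, hre, im_weilMellin_of_real_even he hsupp heven hreal ρ]
  nlinarith [hCS, sq_nonneg (weilMellin e ρ).re]

/-- Stub **EVEN-CS** of crux `OffLineParityDetection` (line `registered`), registered signature: the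
explicit Cauchy–Schwarz threshold.  For a REAL EVEN `L²`-normalised Weil test `e` supported in
`[-a, a]` and the finite set `S` of off-line zeros of `ζ` in the critical strip,
`-Σ_{ρ ∈ S} m(ρ) ∫_{-a}^{a} sinh²((Re ρ - 1/2) t) sin²((Im ρ) t) dt ≤ Σ_{ρ ∈ S} m(ρ) Re ê(ρ)²`:
termwise `neg_integral_sinh_sq_mul_sin_sq_le`, weighted by `m(ρ) ≥ 0`
(`riemannZetaZeroOrder_nonneg`, as `Re ρ < 1` gives `ρ ≠ 1`). [folklore] -/
theorem stub_evenOffLineCauchySchwarz :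
    ∀ (a : ℝ) (e : ℝ → ℂ), IsWeilTest e → tsupport e ⊆ Set.Icc (-a) a → (∀ t, e (-t) = e t) →
      (∀ t, (e t).im = 0) → ∫ t, ‖e t‖ ^ 2 = (1 : ℝ) →
      ∀ hS : ({ρ : ℂ | riemannZeta ρ = 0 ∧ 0 < ρ.re ∧ ρ.re < 1 ∧ ρ.re ≠ 1 / 2}).Finite,
        -(∑ ρ ∈ hS.toFinset, (riemannZetaZeroOrder ρ : ℝ) *
            ∫ t in Set.Icc (-a) a, Real.sinh ((ρ.re - 1 / 2) * t) ^ 2 * Real.sin (ρ.im * t) ^ 2) ≤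
          ∑ ρ ∈ hS.toFinset, (riemannZetaZeroOrder ρ : ℝ) * ((weilMellin e ρ) ^ 2).re := by
  intro a e he hsupp heven hreal hnorm hS
  rw [← Finset.sum_neg_distrib]
  refine Finset.sum_le_sum fun ρ hρ ↦ ?_
  have hmem : ρ ∈ {ρ : ℂ | riemannZeta ρ = 0 ∧ 0 < ρ.re ∧ ρ.re < 1 ∧ ρ.re ≠ 1 / 2} :=
    (Set.Finite.mem_toFinset hS).1 hρ
  have hne : ρ ≠ 1 := by
    rintro rfl
    exact absurd hmem.2.2.1 (by simp)
  have hm : (0 : ℝ) ≤ (riemannZetaZeroOrder ρ : ℝ) := by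
    exact_mod_cast riemannZetaZeroOrder_nonneg hne
  rw [← mul_neg]
  exact mul_le_mul_of_nonneg_left
    (neg_integral_sinh_sq_mul_sin_sq_le he hsupp heven hreal hnorm ρ) hm

end Summit.RiemannHypothesis.RiemannHypothesis.Theorems.WeilParityOffLineParityDetection

end
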